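import Mathlib
import HarnessLib
import Summits.Ventures.LatticeQCDFlow.Exactness.SUNEngineLeapfrogEnergyError
import Summits.Ventures.LatticeQCDFlow.Exactness.SUNWilsonActionGradient

/-!
# THE ENGINE'S `SU(N)` WILSON HMC, NO HYPOTHESES LEFT: `−Re tr(ι c · ι c') = sunCoordPairing c c'`, the Wilson force `(β/2)P(Ω_e)` REPRESENTS the differential of `βS_W` along the drift, and the energy error of the engine's `n`-step leapfrog / OMF2 proposals with the kick `P ← P − ε·F` is `O(nε²)` with explicit, volume-independent constants (every `N ≥ 1`, torus `L ≥ 2`, `β`)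

HONEST FRAMING: exact (Metropolis-corrected) sampling algorithms for lattice gauge theory;
figures of merit are autocorrelation/cost numbers at stated couplings and volumes; no
continuum-physics claim.

Venture `LatticeQCDFlow` (cell pub-lqcd), topic `Exactness`; FANOUT row 14 (`eng-flowhmc`, family B) serving row 21
(`su3-base`, baseline arm `E2 = PBC-HMC` = the engine `latflow.core.hmc.HMC(f, β, 'leapfrog')` on `SU(3)`: momenta in
`sunCoordι`, kinetic term `−tr P²`, kick `P ← P − c·F(U)` with `F_e = (β/2)P(Ω_e)`, drift `U ← exp(εP)U`).  NEW WORK of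
the cell: `SUNEnginePairing` (`B = sunCoordPairing N`, `sunKinetic = ΣB(p_l,p_l)`, `β_B = N + 4·#pairs`, `C_ι = 2N`),
`SUNWilsonActionGradient` (the full differential of `βS_W` along the drift `= −βε Σ_e Re tr(ι(δ_e)·P(Ω_e))`),
`SUNEngineLeapfrogEnergyError` (the engine's leapfrog / OMF2 energy-error laws for any `B`-represented force), row 21's
`SUNWilsonHMCForce` (`sunWilsonForce N β U e`, `sunCoordι_sunWilsonForce`, `‖F‖ ≤ sunWilsonForceSup N d β`,
`‖F(U) − F(U')‖ ≤ sunWilsonForceLip N d β ‖U − U'‖` — VOLUME-INDEPENDENT constants); nothing is cited as a fact; no number.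

* §1 **`re_trace_sunCoordι_mul`** — `Re tr(ι c · ι c') = −sunCoordPairing N c c'`: the engine's kinetic pairing IS `−Re tr`
  (entrywise: diagonal `−d_i d'_i`, each unordered pair `{i<j}` twice `−(R R' + I I')`).
* §2 **`engine_wilsonAction_force_repr`** — for `L ≥ 2` the force field `D = (2ε)•sunWilsonForce N β` REPRESENTS the differential of
  `a ↦ βS_W(e_ε(a)·U)` at `0` through `sunCoordPairing N` (hypothesis `hD` of the laws, DISCHARGED); `engine_wilsonAction_differentiableAt`
  (hypothesis `hd`, DISCHARGED); the consistent half kick is `−D/4 = −(ε/2)•F` — EXACTLY THE ENGINE'S `P ← P − ½εF`.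
* §3 **`engine_wilsonHMC_leapfrog_energy_error_le`** — for every `N ≥ 1`, `d`, torus `L ≥ 2`, `β`, `ε`, `n`, `U`, `p`:
  `|H(Ψ_n(U,p)) − H(U,p)| ≤ n·(N+4#pairs)(2|ε|K_F)·(N²·2N)|ε|·(‖p‖ + (2n+1)|ε|F_max/2)·(Σ_e‖p_e‖ + (2n+1)|E||ε|F_max/2 + |E||ε|F_max/4)`
  with `H = βS_W + sunKinetic`, `Ψ_n = sunLeapfrogProposalN (sunCoordι N) _ ε (−(ε/2)•F) n`, `F_max = sunWilsonForceSup N d β`,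
  `K_F = sunWilsonForceLip N d β` — `O(nε²)`; nothing assumed; **`engine_wilsonHMC_omf2_energy_error_le`** — the same for the
  engine's OMF2 proposal (half-step drift `δ`, kicks `−2λδ•F`, `−2(1−2λ)δ•F`).

NOT CLAIMED: `L = 1`; the mean acceptance under the engine's Gaussian refresh (needs the moments of `e^{−sunKinetic}`);
FT-HMC through a member (the member's Jacobian term is not the Wilson action); optimal constants; floating point; any number.
-/

noncomputable section

namespace Summit.Ventures.LatticeQCDFlow.Exactness

open Set Function NormedSpace
open Literature.MathematicalPhysics.QuantumFieldTheory
open scoped Matrix Matrix.Norms.Operator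

set_option backward.isDefEq.respectTransparency false

/-! ## §1 The engine's kinetic pairing is `−Re tr` -/

section TracePairing

variable (N : ℕ)

set_option maxHeartbeats 400000 in -- RN-23 (7)(b): heavy declaration budgeted at source (lake build ≈ 10 % hungrier than the gate)
/-- **`Re tr(ι c · ι c') = −sunCoordPairing N c c'`**: read in the matrix algebra, the engine's kinetic pairing is minus
the real trace form (so `sunKinetic N p = −Σ_l Re tr P_l²`). -/
theorem re_trace_sunCoordι_mul (c c' : SUNCoords N) :
    ((sunCoordι N c * sunCoordι N c').trace).re = -(sunCoordPairing N c c') := by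
  -- the pair weight
  set w : UpperPair N → ℝ := fun q => c.2.1 q * c'.2.1 q + c.2.2 q * c'.2.2 q with hw
  -- entrywise real parts
  have hent : ∀ i j : Fin N, ((sunCoordι N c) i j * (sunCoordι N c') j i).re =
      -((if i = j then (c.1 : Fin N → ℝ) i * (c'.1 : Fin N → ℝ) i else 0) +
        (if h : i < j then w ⟨(i, j), h⟩ else 0) + (if h' : j < i then w ⟨(j, i), h'⟩ else 0)) := by
    intro i j
    rcases lt_trichotomy i j with h | rfl | h
    · rw [if_neg h.ne, dif_pos h, dif_neg (not_lt.2 h.le), sunCoordι_apply, sunCoordι_apply,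
        sunCoordMatrix_apply_of_lt N _ _ _ h, sunCoordMatrix_apply_of_gt N _ _ _ (i := j) (j := i) h, hw]
      simp only [Complex.mul_re, Complex.add_re, Complex.add_im, Complex.mul_im, Complex.ofReal_re, Complex.ofReal_im,
        Complex.I_re, Complex.I_im, Complex.neg_re, Complex.neg_im]
      ring
    · rw [if_pos rfl, dif_neg (lt_irrefl i), sunCoordι_apply, sunCoordι_apply,
        sunCoordMatrix_apply_self, sunCoordMatrix_apply_self]
      simp only [Complex.mul_re, Complex.mul_im, Complex.ofReal_re, Complex.ofReal_im, Complex.I_re, Complex.I_im]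
      ring
    · rw [if_neg h.ne', dif_neg (not_lt.2 h.le), dif_pos h, sunCoordι_apply, sunCoordι_apply,
        sunCoordMatrix_apply_of_gt N _ _ _ h, sunCoordMatrix_apply_of_lt N _ _ _ (i := j) (j := i) h, hw]
      simp only [Complex.mul_re, Complex.add_re, Complex.add_im, Complex.mul_im, Complex.ofReal_re, Complex.ofReal_im,
        Complex.I_re, Complex.I_im, Complex.neg_re, Complex.neg_im]
      ring
  -- the three sums
  have hdiag : ∑ i : Fin N, ∑ j : Fin N, (if i = j then (c.1 : Fin N → ℝ) i * (c'.1 : Fin N → ℝ) i else 0) =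
      ∑ i : Fin N, (c.1 : Fin N → ℝ) i * (c'.1 : Fin N → ℝ) i := by
    refine Finset.sum_congr rfl fun i _ => ?_
    rw [Finset.sum_ite_eq Finset.univ i, if_pos (Finset.mem_univ i)]
  have hsub : ∑ q : UpperPair N, w q =
      ∑ x ∈ Finset.univ.filter (fun q : Fin N × Fin N => q.1 < q.2), (if h : x.1 < x.2 then w ⟨x, h⟩ else 0) := by
    rw [Finset.sum_subtype (Finset.univ.filter (fun q : Fin N × Fin N => q.1 < q.2))
      (p := fun q : Fin N × Fin N => q.1 < q.2) (fun q => by simp)]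
    refine Finset.sum_congr rfl fun a _ => ?_
    rw [dif_pos a.2]
  have hfilt : ∑ x ∈ Finset.univ.filter (fun q : Fin N × Fin N => q.1 < q.2), (if h : x.1 < x.2 then w ⟨x, h⟩ else 0) =
      ∑ x : Fin N × Fin N, (if h : x.1 < x.2 then w ⟨x, h⟩ else 0) := by
    rw [Finset.sum_filter]
    refine Finset.sum_congr rfl fun x _ => ?_
    by_cases h : x.1 < x.2
    · rw [if_pos h]
    · rw [if_neg h, dif_neg h]
  have hupper : ∑ i : Fin N, ∑ j : Fin N, (if h : i < j then w ⟨(i, j), h⟩ else 0) = ∑ q : UpperPair N, w q := by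
    rw [← Fintype.sum_prod_type' (f := fun i j => if h : i < j then w ⟨(i, j), h⟩ else 0), hsub, hfilt]
  have hlower : ∑ i : Fin N, ∑ j : Fin N, (if h' : j < i then w ⟨(j, i), h'⟩ else 0) = ∑ q : UpperPair N, w q := by
    rw [Finset.sum_comm]
    exact hupper
  -- assemble
  rw [Matrix.trace]
  simp only [Matrix.diag_apply, Matrix.mul_apply]
  rw [Complex.re_sum]
  simp_rw [Complex.re_sum, hent, Finset.sum_neg_distrib, Finset.sum_add_distrib]
  rw [hdiag, hupper, hlower, sunCoordPairing_apply, add_assoc, ← two_mul]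

/-- Hence `sunCoordPairing N c c' = −Re tr(ι c · ι c')` and, with `ι F_e = (β/2)P(Ω_e)`, pairing with a force reads as a trace. -/
theorem sunCoordPairing_eq_neg_re_trace (c c' : SUNCoords N) :
    sunCoordPairing N c c' = -((sunCoordι N c * sunCoordι N c').trace).re := by
  rw [re_trace_sunCoordι_mul, neg_neg]

end TracePairing

/-! ## §2 The Wilson force represents the differential (hypotheses `hd`, `hD` discharged) -/

section Repr

variable (N : ℕ) {d L : ℕ} [NeZero L]

/-- **`hd` DISCHARGED**: `a ↦ βS_W(e_ε(a)·U)` in the engine's coordinates is differentiable at `0` for every `U`. -/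
theorem engine_wilsonAction_differentiableAt (β ε : ℝ) (U : GaugeConfig d L (Matrix.specialUnitaryGroup (Fin N) ℂ)) :
    DifferentiableAt ℝ (fun a : Edge d L → SUNCoords N =>
      β * wilsonAction (suRep N) (sunExpDrift (sunCoordι N) (sunCoordι_skew N) ε a * U)) 0 :=
  differentiableAt_wilsonAction_sunExpDrift N (sunCoordι N) (sunCoordι_skew N) β ε U 0

/-- **`hD` DISCHARGED — THE ENGINE'S WILSON FORCE REPRESENTS THE DIFFERENTIAL OF `βS_W` ALONG THE DRIFT** through the
kinetic pairing: for `L ≥ 2`, `D(a ↦ βS_W(e_ε(a)·U))(0)[δ] = Σ_e sunCoordPairing(((2ε)•F_β)(U)_e, δ_e)` with `F_β = sunWilsonForce N β`. -/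
theorem engine_wilsonAction_force_repr (hL : 2 ≤ L) (β ε : ℝ) (U : GaugeConfig d L (Matrix.specialUnitaryGroup (Fin N) ℂ))
    (δ : Edge d L → SUNCoords N) :
    fderiv ℝ (fun a : Edge d L → SUNCoords N =>
        β * wilsonAction (suRep N) (sunExpDrift (sunCoordι N) (sunCoordι_skew N) ε a * U)) 0 δ =
      ∑ e, sunCoordPairing N (((2 * ε) • sunWilsonForce N β) U e) (δ e) := by
  rw [fderiv_wilsonAction_sunExpDrift_apply_suProj N (sunCoordι N) (sunCoordι_skew N) hL β ε U δ]
  refine Finset.sum_congr rfl fun e _ => ?_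
  rw [sunCoordPairing_comm, sunCoordPairing_eq_neg_re_trace, Pi.smul_apply, Pi.smul_apply, map_smul,
    sunCoordι_sunWilsonForce, smul_smul, Matrix.mul_smul, Matrix.trace_smul, Complex.real_smul, Complex.re_ofReal_mul]
  ring

end Repr

/-! ## §3 The engine's Wilson HMC: energy error of the leapfrog and OMF2 proposals, nothing assumed -/

section Engine

variable (N : ℕ) [NeZero N] {d L : ℕ} [NeZero L]

set_option maxHeartbeats 400000 in -- RN-23 (7)(b): heavy declaration budgeted at source (lake build ≈ 10 % hungrier than the gate)
/-- **THE ENGINE'S `SU(N)` WILSON HMC — ENERGY ERROR OF THE `n`-STEP LEAPFROG PROPOSAL, NOTHING ASSUMED** (`N ≥ 1`, torus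
`L ≥ 2`, every `d`, `β`, `ε`, `n`, configuration `U`, momenta `p`; `H = βS_W + sunKinetic`, kick `P ← P − ½ε·F_β`,
`F_β = sunWilsonForce N β`, `F_max = sunWilsonForceSup N d β`, `K_F = sunWilsonForceLip N d β` — volume-independent):
`|H(Ψ_n(U,p)) − H(U,p)| ≤ n·(N+4#pairs)(2|ε|K_F)·(N²·2N)|ε|·(‖p‖ + (2n+1)(2|ε|F_max)/4)·(Σ_e‖p_e‖ + (2n+1)|E|(2|ε|F_max)/4 + |E|(2|ε|F_max)/8)`
— second order in `ε` at fixed `n`, `O(τε)` at fixed trajectory length. -/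
theorem engine_wilsonHMC_leapfrog_energy_error_le (hL : 2 ≤ L) (β ε : ℝ)
    (U : GaugeConfig d L (Matrix.specialUnitaryGroup (Fin N) ℂ)) (p : Edge d L → SUNCoords N) (n : ℕ) :
    |(β * wilsonAction (suRep N) (sunLeapfrogProposalN (sunCoordι N) (sunCoordι_skew N) ε
          (-(ε / 2) • sunWilsonForce N β) n (U, p)).1 +
        sunKinetic N (sunLeapfrogProposalN (sunCoordι N) (sunCoordι_skew N) ε (-(ε / 2) • sunWilsonForce N β) n (U, p)).2) -
      (β * wilsonAction (suRep N) U + sunKinetic N p)| ≤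
      n * ((N + 4 * Fintype.card (UpperPair N)) * (2 * |ε| * sunWilsonForceLip N d β) *
          ((Fintype.card (Fin N) : ℝ) ^ 2 * (2 * N) * |ε| * (‖p‖ + (2 * n + 1) * (2 * |ε| * sunWilsonForceSup N d β / 4))) *
        ((∑ e, ‖p e‖ + (2 * n + 1) * (Fintype.card (Edge d L) * (2 * |ε| * sunWilsonForceSup N d β / 4))) +
          Fintype.card (Edge d L) * (2 * |ε| * sunWilsonForceSup N d β) / 8)) := by
  have hD0 : 0 ≤ 2 * |ε| * sunWilsonForceSup N d β := by
    have := sunWilsonForceSup_nonneg N d β; positivity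
  have hK0 : 0 ≤ 2 * |ε| * sunWilsonForceLip N d β := by
    have := sunWilsonForceLip_nonneg N d β; positivity
  have hDb : ∀ (W : GaugeConfig d L (Matrix.specialUnitaryGroup (Fin N) ℂ)) (e : Edge d L),
      ‖((2 * ε) • sunWilsonForce N β) W e‖ ≤ 2 * |ε| * sunWilsonForceSup N d β := by
    intro W e
    rw [Pi.smul_apply, Pi.smul_apply, norm_smul, Real.norm_eq_abs, abs_mul, abs_two]
    exact mul_le_mul_of_nonneg_left (norm_sunWilsonForce_le N β W e) (by positivity)
  have hDK : ∀ W W' : GaugeConfig d L (Matrix.specialUnitaryGroup (Fin N) ℂ),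
      ‖((2 * ε) • sunWilsonForce N β) W - ((2 * ε) • sunWilsonForce N β) W'‖ ≤
        2 * |ε| * sunWilsonForceLip N d β * ‖coeConfig W - coeConfig W'‖ := by
    intro W W'
    have e1 : ((2 * ε) • sunWilsonForce N β) W - ((2 * ε) • sunWilsonForce N β) W' =
        (2 * ε) • (sunWilsonForce N β W - sunWilsonForce N β W') := by
      rw [smul_sub]; rfl
    rw [e1, norm_smul, Real.norm_eq_abs, abs_mul, abs_two, mul_assoc (2 * |ε|)]
    exact mul_le_mul_of_nonneg_left (norm_sunWilsonForce_sub_le N β W W') (by positivity)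
  have hg : ∀ (W : GaugeConfig d L (Matrix.specialUnitaryGroup (Fin N) ℂ)) (l : Edge d L),
      (-(ε / 2) • sunWilsonForce N β) W l = -(1 / 4 : ℝ) • ((2 * ε) • sunWilsonForce N β) W l := by
    intro W l
    simp only [Pi.smul_apply, smul_smul]
    congr 1
    ring
  exact engine_sunLeapfrogProposalN_energy_error_le N (fun W => β * wilsonAction (suRep N) W) ε
    (fun W => engine_wilsonAction_differentiableAt N β ε W) ((2 * ε) • sunWilsonForce N β) (-(ε / 2) • sunWilsonForce N β)
    (fun W δ => engine_wilsonAction_force_repr N hL β ε W δ) hD0 hK0 hDb hDK hg U p n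

set_option maxHeartbeats 400000 in -- RN-23 (7)(b): heavy declaration budgeted at source (lake build ≈ 10 % hungrier than the gate)
/-- **THE ENGINE'S `SU(N)` WILSON HMC — ENERGY ERROR OF THE `n`-STEP OMF2 PROPOSAL, NOTHING ASSUMED** (half-step drift
`δ`, kicks `P ← P − 2λδ·F_β`, `P ← P − 2(1−2λ)δ·F_β` — the fractions `λ, 1−2λ, λ` of the full-step kick `2δ·F_β`):
with `γ₂ = (2|λ|+|1−2λ|)·2|δ|F_max`,
`|H(Ψ_n(U,p)) − H(U,p)| ≤ n·(N+4#pairs)(2|δ|K_F)·(N²·2N)|δ|·(‖p‖ + (n+1)γ₂)·((|1−2λ|+2|λ|+1)(Σ_e‖p_e‖ + (n+1)|E|γ₂) + 4λ²|E|·2|δ|F_max)`. -/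
theorem engine_wilsonHMC_omf2_energy_error_le (hL : 2 ≤ L) (β δ lam : ℝ)
    (U : GaugeConfig d L (Matrix.specialUnitaryGroup (Fin N) ℂ)) (p : Edge d L → SUNCoords N) (n : ℕ) :
    |(β * wilsonAction (suRep N) (((flip : Equiv.Perm ((Edge d L → Matrix.specialUnitaryGroup (Fin N) ℂ) × (Edge d L → SUNCoords N))) *
          omf2Word ((-(2 * lam * δ)) • sunWilsonForce N (d := d) (L := L) β)
            (mulDrift (sunExpDrift (sunCoordι N) (sunCoordι_skew N) δ))
            ((-(2 * (1 - 2 * lam) * δ)) • sunWilsonForce N (d := d) (L := L) β) ^ n) (U, p)).1 +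
        sunKinetic N (((flip : Equiv.Perm ((Edge d L → Matrix.specialUnitaryGroup (Fin N) ℂ) × (Edge d L → SUNCoords N))) *
          omf2Word ((-(2 * lam * δ)) • sunWilsonForce N (d := d) (L := L) β)
            (mulDrift (sunExpDrift (sunCoordι N) (sunCoordι_skew N) δ))
            ((-(2 * (1 - 2 * lam) * δ)) • sunWilsonForce N (d := d) (L := L) β) ^ n) (U, p)).2) -
      (β * wilsonAction (suRep N) U + sunKinetic N p)| ≤
      n * ((N + 4 * Fintype.card (UpperPair N)) * (2 * |δ| * sunWilsonForceLip N d β) * ((Fintype.card (Fin N) : ℝ) ^ 2 * (2 * N)) * |δ| *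
          (‖p‖ + (n + 1) * ((2 * |lam| + |1 - 2 * lam|) * (2 * |δ| * sunWilsonForceSup N d β))) *
        ((|1 - 2 * lam| + 2 * |lam| + 1) *
            (∑ e, ‖p e‖ + (n + 1) * (Fintype.card (Edge d L) * ((2 * |lam| + |1 - 2 * lam|) * (2 * |δ| * sunWilsonForceSup N d β)))) +
          4 * lam ^ 2 * (Fintype.card (Edge d L) * (2 * |δ| * sunWilsonForceSup N d β)))) := by
  have hD0 : 0 ≤ 2 * |δ| * sunWilsonForceSup N d β := by
    have := sunWilsonForceSup_nonneg N d β; positivity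
  have hK0 : 0 ≤ 2 * |δ| * sunWilsonForceLip N d β := by
    have := sunWilsonForceLip_nonneg N d β; positivity
  have hDb : ∀ (W : GaugeConfig d L (Matrix.specialUnitaryGroup (Fin N) ℂ)) (e : Edge d L),
      ‖((2 * δ) • sunWilsonForce N β) W e‖ ≤ 2 * |δ| * sunWilsonForceSup N d β := by
    intro W e
    rw [Pi.smul_apply, Pi.smul_apply, norm_smul, Real.norm_eq_abs, abs_mul, abs_two]
    exact mul_le_mul_of_nonneg_left (norm_sunWilsonForce_le N β W e) (by positivity)
  have hDK : ∀ W W' : GaugeConfig d L (Matrix.specialUnitaryGroup (Fin N) ℂ),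
      ‖((2 * δ) • sunWilsonForce N β) W - ((2 * δ) • sunWilsonForce N β) W'‖ ≤
        2 * |δ| * sunWilsonForceLip N d β * ‖coeConfig W - coeConfig W'‖ := by
    intro W W'
    have e1 : ((2 * δ) • sunWilsonForce N β) W - ((2 * δ) • sunWilsonForce N β) W' =
        (2 * δ) • (sunWilsonForce N β W - sunWilsonForce N β W') := by
      rw [smul_sub]; rfl
    rw [e1, norm_smul, Real.norm_eq_abs, abs_mul, abs_two, mul_assoc (2 * |δ|)]
    exact mul_le_mul_of_nonneg_left (norm_sunWilsonForce_sub_le N β W W') (by positivity)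
  have hg₁ : ∀ (W : GaugeConfig d L (Matrix.specialUnitaryGroup (Fin N) ℂ)) (l : Edge d L),
      (-(2 * lam * δ) • sunWilsonForce N β) W l = -lam • ((2 * δ) • sunWilsonForce N β) W l := by
    intro W l
    simp only [Pi.smul_apply, smul_smul]
    congr 1
    ring
  have hg₂ : ∀ (W : GaugeConfig d L (Matrix.specialUnitaryGroup (Fin N) ℂ)) (l : Edge d L),
      (-(2 * (1 - 2 * lam) * δ) • sunWilsonForce N β) W l = -(1 - 2 * lam) • ((2 * δ) • sunWilsonForce N β) W l := by
    intro W l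
    simp only [Pi.smul_apply, smul_smul]
    congr 1
    ring
  exact engine_sunOmf2ProposalN_energy_error_le N (fun W => β * wilsonAction (suRep N) W) δ lam
    (fun W => engine_wilsonAction_differentiableAt N β δ W) ((2 * δ) • sunWilsonForce N β)
    (-(2 * lam * δ) • sunWilsonForce N β) (-(2 * (1 - 2 * lam) * δ) • sunWilsonForce N β)
    (fun W v => engine_wilsonAction_force_repr N hL β δ W v) hD0 hK0 hDb hDK hg₁ hg₂ U p n

end Engine

end Summit.Ventures.LatticeQCDFlow.Exactness
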